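import Literature.NumberTheory.Automorphic.UnitaryTwoRamifiedTreeAction          -- ★ B-p08 (g28) p843858: `rhoVertexActPlace`, `rhoVertexActPlace_eq_iff_exists_zpow`
import HarnessLib

/-!
# The TORUS STEP of the Euler–Poincaré relation at a ramified place: `t_η = diag(η, (σ_w η)⁻¹) ∈ U(Φ₂)(L_w)` moves the root `𝒪²` of the tree of `SL₂(L⁺_v)` to
# its neighbour `ϖ𝒪 ⊕ 𝒪`, and the neighbour `𝒪 ⊕ ϖ𝒪` back to the root (Serre, *Trees* II.1.2–1.3; Kottwitz 1988 §2; Laumon 1996 §4)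

Topic `NumberTheory/Automorphic`; namespace `Literature.NumberTheory.Automorphic.UnitaryGroup`.  THEOREMS ONLY (no definition, no instance, no notation, no named fact, no
`sorry`); kernel lane.  Cell `pub/hodgecm-mathlib` (D-0151), crux H413 = `stmt-HodgeConjecture-24833`, line «N6nsGerm», residue «R2EP-wild» of `stub_N6nsR2EP :
RankOneEulerPoincareNonsplit`, ROAD W — the `hstep` binder of A-p06 (g28)'s (W6-N) ★ `epNonEllipticRelation_vertexEdgeLevels_of_vertexAction_local(′)`
(`hstep : ∀ u, ↑↑u = diagonal ![↑ϖ, (σ_w ↑ϖ)⁻¹] → X.Adj x₀ (act u x₀)`) at `act := rhoVertexActPlace …`, for both keyings `x₀ = v₀ = latt 1` (`√u`-type) and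
`x₀ = v₁ = latt diag(1, ϖ_F)` (`√π`-type) (owner B-p10 (g26) WORD W-3).  HONEST LABEL: HC_CM is proved only modulo the cell's 2 remaining named inputs (hLiu418, h413)
until rung 0 closes; nothing printed is asserted here.

THE MATHEMATICS.  For a uniformiser `η` of `L_w` the torus element `t_η = diag(η, (σ_w η)⁻¹)` is unitary and DIAGONAL, so `diag(1,α)` commutes with it and its descent
representative is explicit: `t_η = (σ_w η)⁻¹ · ι(diag(c, 1))` with `ι(c) = η · σ_w(η) = N(η)` (`σ_w`-fixed, ★ `exists_toPlace_eq_of_galAdicCompletionMap_eq`) and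
`|c|_v = |ϖ_F|_v` (`e(w|v) = 2`).  By ★ `rhoVertexActPlace_eq_iff_exists_zpow`, `ρ_w(t_η) · M = N ↔ N = ϖ_F^k · diag(c,1) M`: at the root `M = 𝒪²` (`k = 0`) this is
`c𝒪 ⊕ 𝒪 = ϖ_F𝒪 ⊕ 𝒪`, a `ϖ_F`-modular NEIGHBOUR of the root (`latticeTree_adj_root_rhoVertexActPlace_of_coe_eq_diagonal`); at `M = 𝒪 ⊕ ϖ_F𝒪` (`k = −1`) it is
`ϖ_F⁻¹(c𝒪 ⊕ ϖ_F𝒪) ∼ 𝒪²`, the root, adjacent by ★ `latticeTree_adj_root` (`…_of_coe_eq_diagonal'`).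

## References
* [Serre1980Trees] J.-P. Serre, *Trees* (1980), Ch. II §1.2–§1.3.
* [Kottwitz1988] R. E. Kottwitz, *Tamagawa numbers*, Ann. of Math. 127 (1988), §2.
* [Tits1979] J. Tits, *Reductive groups over local fields*, PSPM 33.1 (1979), §3.9.
-/

set_option autoImplicit false

noncomputable section

open NumberField IsDedekindDomain
open scoped Matrix ValuativeRel MatrixGroups
open Matrix ValuativeRel

namespace Literature.NumberTheory.Automorphic.UnitaryGroup

open Literature.NumberTheory.Automorphic Literature.NumberTheory.Automorphic.HermitianLatticeTree

section Place

variable (L : Type) [Field L] [NumberField L] [IsCMField L] (v : HeightOneSpectrum (𝓞 ↥(maximalRealSubfield L)))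
  (w : PlacesOver L v) (hw : IsCMField.complexConj L • w.1 = w.1)
  {α : w.1.adicCompletion L} (hα : galAdicCompletionMap (L := L) (IsCMField.complexConj L) hw α = -α) (hα0 : α ≠ 0)
  {ϖF : v.adicCompletion ↥(maximalRealSubfield L)} (hϖF : Valued.v ϖF = WithZero.exp (-1 : ℤ))
  (he : v.asIdeal.ramificationIdx' w.1.asIdeal ≠ 1) (η : (w.1.adicCompletion L)ˣ) (hη : Valued.v (η : w.1.adicCompletion L) = WithZero.exp (-1 : ℤ))

/-! ## §1 The norm of a uniformiser of `L_w` descends to an element of valuation `|ϖ_F|` -/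

include hw hϖF he hη in
/-- **`N(η) = η σ_w(η)` DESCENDS**: there is `c ∈ L⁺_v` with `ι(c) = η σ_w(η)` and `|c|_v = |ϖ_F|_v` (`e(w|v) = 2`). [cite: Serre1980Trees, Ch. II §1.2] [cite: Tits1979, §3.9] -/
theorem exists_toPlace_eq_mul_galAdicCompletionMap_of_ramified :
    ∃ c : v.adicCompletion ↥(maximalRealSubfield L),
      toPlace v w c = (η : w.1.adicCompletion L) * galAdicCompletionMap (L := L) (IsCMField.complexConj L) hw (η : w.1.adicCompletion L) ∧
        valuation (v.adicCompletion ↥(maximalRealSubfield L)) c = valuation (v.adicCompletion ↥(maximalRealSubfield L)) ϖF := by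
  have hc1 : IsCMField.complexConj L ≠ 1 := IsCMField.complexConj_ne_one L
  have hfix : galAdicCompletionMap (L := L) (IsCMField.complexConj L) hw
      ((η : w.1.adicCompletion L) * galAdicCompletionMap (L := L) (IsCMField.complexConj L) hw (η : w.1.adicCompletion L)) =
      (η : w.1.adicCompletion L) * galAdicCompletionMap (L := L) (IsCMField.complexConj L) hw (η : w.1.adicCompletion L) := by
    rw [map_mul, galAdicCompletionMap_galAdicCompletionMap_of_smul_eq (IsCMField.complexConj L) w hc1 hw, mul_comm]
  obtain ⟨c, hc⟩ := exists_toPlace_eq_of_galAdicCompletionMap_eq (IsCMField.complexConj L) w hc1 hw _ hfix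
  refine ⟨c, hc, ?_⟩
  have h2 : Valued.v (toPlace v w c) = Valued.v c ^ 2 := by
    rw [valued_toPlace, Liu2021.LemD1IndexedNonVacuityRamifiedPlace.ramificationIdx'_eq_two_of_ne_one L v (IsCMField.complexConj L) hc1 w hw he]
  have hsq : Valued.v c ^ 2 = Valued.v ϖF ^ 2 := by
    rw [← h2, hc, map_mul, valued_galAdicCompletionMap, hη, hϖF, pow_two]
  exact (v_eq_iff_valuation_eq c ϖF).1 (eq_of_sq_eq_sq hsq)

/-! ## §2 The descent representative of `t_η` and the torus step -/

include hw hα0 hϖF he hη in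
/-- **THE DESCENT REPRESENTATIVE OF THE TORUS ELEMENT**: if `↑u = diag(η, (σ_w η)⁻¹)`, then `diag(1,α) u diag(1,α)⁻¹ = (σ_w η)⁻¹ · ι(g)` for a `g ∈ GL₂(L⁺_v)` with
`↑g = diag(c, 1)`, `|c|_v = |ϖ_F|_v`. [cite: Serre1980Trees, Ch. II §1.2–§1.3] [cite: Tits1979, §3.9] -/
theorem exists_descent_of_coe_eq_diagonal
    (u : ↥(unitaryGroupOfForm (galAdicCompletionMap (L := L) (IsCMField.complexConj L) hw)
      (placeForm (Matrix.of fun i j : Fin 2 => if i.val + j.val + 1 = 2 then (1 : L) else 0) w.1)))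
    (hu : ((u : GL (Fin 2) (w.1.adicCompletion L)) : Matrix (Fin 2) (Fin 2) (w.1.adicCompletion L)) =
      Matrix.diagonal ![(η : w.1.adicCompletion L), (galAdicCompletionMap (L := L) (IsCMField.complexConj L) hw (η : w.1.adicCompletion L))⁻¹]) :
    ∃ (c : v.adicCompletion ↥(maximalRealSubfield L)) (g : GL (Fin 2) (v.adicCompletion ↥(maximalRealSubfield L))),
      valuation (v.adicCompletion ↥(maximalRealSubfield L)) c = valuation (v.adicCompletion ↥(maximalRealSubfield L)) ϖF ∧
      (g : Matrix (Fin 2) (Fin 2) (v.adicCompletion ↥(maximalRealSubfield L))) = Matrix.diagonal ![c, 1] ∧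
      (galAdicCompletionMap (L := L) (IsCMField.complexConj L) hw (η : w.1.adicCompletion L))⁻¹ ≠ 0 ∧
      Matrix.diagonal ![1, α] * ((u : GL (Fin 2) (w.1.adicCompletion L)) : Matrix (Fin 2) (Fin 2) (w.1.adicCompletion L)) * Matrix.diagonal ![1, α⁻¹] =
        (galAdicCompletionMap (L := L) (IsCMField.complexConj L) hw (η : w.1.adicCompletion L))⁻¹ •
          (g : Matrix (Fin 2) (Fin 2) (v.adicCompletion ↥(maximalRealSubfield L))).map (toPlace v w) := by
  obtain ⟨c, hc, hval⟩ := exists_toPlace_eq_mul_galAdicCompletionMap_of_ramified L v w hw hϖF he η hη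
  have hη0 : (η : w.1.adicCompletion L) ≠ 0 := η.ne_zero
  have hση0 : galAdicCompletionMap (L := L) (IsCMField.complexConj L) hw (η : w.1.adicCompletion L) ≠ 0 := by rw [map_ne_zero]; exact hη0
  have hc0 : c ≠ 0 := by
    intro h0; rw [h0, map_zero] at hc; exact mul_ne_zero hη0 hση0 hc.symm
  have hdet : (Matrix.diagonal ![c, (1 : v.adicCompletion ↥(maximalRealSubfield L))]).det ≠ 0 := by
    rw [det_diagonal, Fin.prod_univ_two]; simp [hc0]
  refine ⟨c, Matrix.GeneralLinearGroup.mk'' _ (isUnit_iff_ne_zero.2 hdet), hval, rfl, inv_ne_zero hση0, ?_⟩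
  rw [hu]
  show Matrix.diagonal ![1, α] * Matrix.diagonal ![(η : w.1.adicCompletion L), (galAdicCompletionMap (L := L) (IsCMField.complexConj L) hw (η : w.1.adicCompletion L))⁻¹] *
      Matrix.diagonal ![1, α⁻¹] = (galAdicCompletionMap (L := L) (IsCMField.complexConj L) hw (η : w.1.adicCompletion L))⁻¹ •
        (Matrix.diagonal ![c, (1 : v.adicCompletion ↥(maximalRealSubfield L))]).map (toPlace v w)
  rw [diagonal_mul_diagonal, diagonal_mul_diagonal, Matrix.diagonal_map (map_zero _), ← Matrix.diagonal_smul]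
  congr 1
  funext i
  fin_cases i <;> simp [hc] <;> field_simp

omit [IsCMField L] in
/-- `diag(c, 1) = diag(ϖ^1, ϖ^0) · diag(c∕ϖ, 1)` — the frame of the OTHER `ϖ`-modular neighbour of the root: `latt diag(c, 1) = latt (1 · diag(ϖ_F¹, ϖ_F⁰))` for `|c| = |ϖ_F|`.
[cite: Serre1980Trees, Ch. II §1.1] -/
theorem latt_diagonal_eq_latt_one_mul_diagonal_zpow {c : v.adicCompletion ↥(maximalRealSubfield L)}
    (hc : valuation (v.adicCompletion ↥(maximalRealSubfield L)) c = valuation (v.adicCompletion ↥(maximalRealSubfield L)) ϖF) (h0 : ϖF ≠ 0) :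
    latt (Matrix.diagonal ![c, (1 : v.adicCompletion ↥(maximalRealSubfield L))]) =
      latt (((1 : GL (Fin 2) (v.adicCompletion ↥(maximalRealSubfield L))) : Matrix (Fin 2) (Fin 2) (v.adicCompletion ↥(maximalRealSubfield L))) *
        Matrix.diagonal ![ϖF ^ (1 : ℤ), ϖF ^ (0 : ℤ)]) := by
  have hv0 : valuation (v.adicCompletion ↥(maximalRealSubfield L)) ϖF ≠ 0 := (Valuation.ne_zero_iff _).2 h0
  have hcu : valuation (v.adicCompletion ↥(maximalRealSubfield L)) (c / ϖF) = 1 := by rw [map_div₀, hc, div_self hv0]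
  have hdet : (Matrix.diagonal ![ϖF ^ (1 : ℤ), ϖF ^ (0 : ℤ)]).det ≠ 0 := by
    rw [det_diagonal, Fin.prod_univ_two]; simp [h0]
  set P : GL (Fin 2) (v.adicCompletion ↥(maximalRealSubfield L)) := Matrix.GeneralLinearGroup.mk'' _ (isUnit_iff_ne_zero.2 hdet) with hP
  have hPval : (P : Matrix (Fin 2) (Fin 2) (v.adicCompletion ↥(maximalRealSubfield L))) = Matrix.diagonal ![ϖF ^ (1 : ℤ), ϖF ^ (0 : ℤ)] := rfl
  -- a diagonal `GL₂(𝒪)` element `D' = diag(c/ϖ, 1)`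
  have hdet' : (Matrix.diagonal ![c / ϖF, (1 : v.adicCompletion ↥(maximalRealSubfield L))]).det ≠ 0 := by
    rw [det_diagonal, Fin.prod_univ_two]
    have hc0 : c ≠ 0 := fun h => hv0 (by rw [← hc, h, map_zero])
    simp [div_ne_zero hc0 h0]
  set D' : GL (Fin 2) (v.adicCompletion ↥(maximalRealSubfield L)) := Matrix.GeneralLinearGroup.mk'' _ (isUnit_iff_ne_zero.2 hdet') with hD'
  have hD'val : (D' : Matrix (Fin 2) (Fin 2) (v.adicCompletion ↥(maximalRealSubfield L))) = Matrix.diagonal ![c / ϖF, 1] := rfl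
  have hD'K : D' ∈ glInt 2 (v.adicCompletion ↥(maximalRealSubfield L)) := by
    refine mem_glInt_of_isIntegralMatrix (fun i j => ?_) (by rw [hD'val, det_diagonal, Fin.prod_univ_two]; simp [hcu])
    rw [hD'val]
    fin_cases i <;> fin_cases j <;> first | (simp [Valuation.mem_integer_iff]; done) | simpa [Valuation.mem_integer_iff] using hcu.le
  have hprod : ((P * D' : GL (Fin 2) (v.adicCompletion ↥(maximalRealSubfield L))) : Matrix (Fin 2) (Fin 2) (v.adicCompletion ↥(maximalRealSubfield L))) =
      Matrix.diagonal ![c, 1] := by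
    rw [Units.val_mul, hPval, hD'val, diagonal_mul_diagonal]
    congr 1
    funext i
    fin_cases i <;> simp [mul_div_cancel₀ c h0]
  rw [← hprod, latt_mul_of_mem_glInt _ _ hD'K, hPval, Units.val_one, one_mul]

include he hη in
/-- **THE TORUS STEP AT THE ROOT (`√u`-keying, `x₀ = v₀ = 𝒪²`)**: if `↑u = diag(η, (σ_w η)⁻¹)` for a uniformiser `η` of `L_w`, then `ρ_w(u) · x₀ = c𝒪 ⊕ 𝒪 = ϖ_F𝒪 ⊕ 𝒪`
is ADJACENT to `x₀` — the binder `hstep` of ★ (W6-N) `…_of_vertexAction_local′`. [cite: Serre1980Trees, Ch. II §1.2–§1.3] [cite: Kottwitz1988, §2] -/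
theorem latticeTree_adj_root_rhoVertexActPlace_of_coe_eq_diagonal
    (x₀ : {M : Submodule 𝒪[v.adicCompletion ↥(maximalRealSubfield L)] (Fin 2 → v.adicCompletion ↥(maximalRealSubfield L)) //
      IsSpecialLattice (RingHom.id _) ϖF !![(0 : v.adicCompletion ↥(maximalRealSubfield L)), 1; -1, 0] M})
    (hx₀ : x₀.1 = latt (1 : Matrix (Fin 2) (Fin 2) (v.adicCompletion ↥(maximalRealSubfield L))))
    (u : ↥(unitaryGroupOfForm (galAdicCompletionMap (L := L) (IsCMField.complexConj L) hw)
      (placeForm (Matrix.of fun i j : Fin 2 => if i.val + j.val + 1 = 2 then (1 : L) else 0) w.1)))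
    (hu : ((u : GL (Fin 2) (w.1.adicCompletion L)) : Matrix (Fin 2) (Fin 2) (w.1.adicCompletion L)) =
      Matrix.diagonal ![(η : w.1.adicCompletion L), (galAdicCompletionMap (L := L) (IsCMField.complexConj L) hw (η : w.1.adicCompletion L))⁻¹]) :
    (latticeTree (RingHom.id _) ϖF !![(0 : v.adicCompletion ↥(maximalRealSubfield L)), 1; -1, 0]).Adj x₀ (rhoVertexActPlace L v w hw hα hα0 hϖF u x₀) := by
  have hϖ' : IsUniformizingElement ϖF := isUniformizingElement_of_v_eq hϖF
  have h0 : ϖF ≠ 0 := hϖ'.ne_zero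
  obtain ⟨c, g, hc, hg, hs, hsg⟩ := exists_descent_of_coe_eq_diagonal L v w hw hα0 hϖF he η hη u hu
  -- the target vertex `N₁ = latt diag(c, 1)`, `ϖ_F`-modular
  have hmod : IsModularLattice (RingHom.id _) ϖF !![(0 : v.adicCompletion ↥(maximalRealSubfield L)), 1; -1, 0]
      (latt (Matrix.diagonal ![c, (1 : v.adicCompletion ↥(maximalRealSubfield L))])) :=
    (isModularLattice_id_altJ_iff h0 _).2 ⟨g, by rw [hg], by rw [hg, det_diagonal, Fin.prod_univ_two]; simp [hc]⟩
  have hρ : rhoVertexActPlace L v w hw hα hα0 hϖF u x₀ = ⟨_, Or.inr hmod⟩ :=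
    (rhoVertexActPlace_eq_iff_exists_zpow L v w hw hα hα0 hϖF u hs hsg x₀ _).2 ⟨0, by rw [zpow_zero, scaleLattice_one, hx₀, mapGL_latt_one, hg]⟩
  rw [hρ, latticeTree_adj_iff]
  have hsd : IsSelfDualLattice (RingHom.id _) !![(0 : v.adicCompletion ↥(maximalRealSubfield L)), 1; -1, 0] x₀.1 := by
    rw [hx₀]; exact (isSelfDualLattice_id_altJ_iff _).2 ⟨1, by rw [Units.val_one], by rw [Units.val_one, det_one, map_one]⟩
  refine ⟨fun heq => not_isModularLattice_of_isSelfDualLattice (RingHom.id _) (fun _ => rfl) hϖ' _ hsd (?_ : IsModularLattice _ _ _ x₀.1),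
    Or.inl ⟨hsd, hmod, ?_, ?_⟩⟩
  · have h1 := congrArg Subtype.val heq
    simp only at h1
    rw [h1]; exact hmod
  · -- `ϖ𝒪² = latt (1·diag(ϖ¹,ϖ¹)) ≤ latt (1·diag(ϖ¹, ϖ⁰)) = latt diag(c, 1)`
    show scaleLattice ϖF x₀.1 ≤ latt (Matrix.diagonal ![c, 1])
    rw [hx₀, show scaleLattice (E := v.adicCompletion ↥(maximalRealSubfield L)) ϖF = scaleLattice (ϖF ^ (1 : ℤ)) by rw [zpow_one],
      latt_one_eq_latt_mul_diagonal_zero (ϖ := ϖF) 1 (one_mem _), scaleLattice_zpow_latt_mul_diagonal hϖ',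
      latt_diagonal_eq_latt_one_mul_diagonal_zpow L v hc h0, latt_mul_diagonal_le_iff hϖ']
    norm_num
  · show latt (Matrix.diagonal ![c, 1]) ≤ x₀.1
    rw [hx₀, latt_diagonal_eq_latt_one_mul_diagonal_zpow L v hc h0, latt_one_eq_latt_mul_diagonal_zero (ϖ := ϖF) 1 (one_mem _),
      latt_mul_diagonal_le_iff hϖ']
    norm_num

include he hη in
/-- **THE TORUS STEP AT THE ROOT'S NEIGHBOUR (`√π`-keying, `x₀ = v₁ = 𝒪 ⊕ ϖ_F𝒪`)**: if `↑u = diag(η, (σ_w η)⁻¹)`, then `ρ_w(u) · x₀ = ϖ_F⁻¹ (c𝒪 ⊕ ϖ_F𝒪) = 𝒪²` is the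
ROOT, adjacent to `x₀` (★ `latticeTree_adj_root`). [cite: Serre1980Trees, Ch. II §1.2–§1.3] [cite: Kottwitz1988, §2] -/
theorem latticeTree_adj_root_rhoVertexActPlace_of_coe_eq_diagonal'
    (x₀ : {M : Submodule 𝒪[v.adicCompletion ↥(maximalRealSubfield L)] (Fin 2 → v.adicCompletion ↥(maximalRealSubfield L)) //
      IsSpecialLattice (RingHom.id _) ϖF !![(0 : v.adicCompletion ↥(maximalRealSubfield L)), 1; -1, 0] M})
    (hx₀ : x₀.1 = latt (Matrix.diagonal ![1, ϖF]))
    (u : ↥(unitaryGroupOfForm (galAdicCompletionMap (L := L) (IsCMField.complexConj L) hw)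
      (placeForm (Matrix.of fun i j : Fin 2 => if i.val + j.val + 1 = 2 then (1 : L) else 0) w.1)))
    (hu : ((u : GL (Fin 2) (w.1.adicCompletion L)) : Matrix (Fin 2) (Fin 2) (w.1.adicCompletion L)) =
      Matrix.diagonal ![(η : w.1.adicCompletion L), (galAdicCompletionMap (L := L) (IsCMField.complexConj L) hw (η : w.1.adicCompletion L))⁻¹]) :
    (latticeTree (RingHom.id _) ϖF !![(0 : v.adicCompletion ↥(maximalRealSubfield L)), 1; -1, 0]).Adj x₀ (rhoVertexActPlace L v w hw hα hα0 hϖF u x₀) := by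
  have hϖ' : IsUniformizingElement ϖF := isUniformizingElement_of_v_eq hϖF
  haveI : IsDiscreteValuationRing 𝒪[v.adicCompletion ↥(maximalRealSubfield L)] := isDiscreteValuationRing_integer_of_compatible hϖF
  have h0 : ϖF ≠ 0 := hϖ'.ne_zero
  have hv0 : valuation (v.adicCompletion ↥(maximalRealSubfield L)) ϖF ≠ 0 := (Valuation.ne_zero_iff _).2 h0
  obtain ⟨c, g, hc, hg, hs, hsg⟩ := exists_descent_of_coe_eq_diagonal L v w hw hα0 hϖF he η hη u hu
  obtain ⟨g₁, hg₁, -⟩ := exists_coe_eq_diagonal_one_uniformizer (F := v.adicCompletion ↥(maximalRealSubfield L)) h0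
  have hcu : valuation (v.adicCompletion ↥(maximalRealSubfield L)) (c / ϖF) = 1 := by rw [map_div₀, hc, div_self hv0]
  -- the root as a vertex
  have hsd : IsSelfDualLattice (RingHom.id _) !![(0 : v.adicCompletion ↥(maximalRealSubfield L)), 1; -1, 0]
      (latt (1 : Matrix (Fin 2) (Fin 2) (v.adicCompletion ↥(maximalRealSubfield L)))) :=
    (isSelfDualLattice_id_altJ_iff _).2 ⟨1, by rw [Units.val_one], by rw [Units.val_one, det_one, map_one]⟩
  -- `g · (𝒪 ⊕ ϖ𝒪) = latt (g g₁) = latt diag(c, ϖ) = ϖ · latt diag(c/ϖ, 1)·… = ϖ · 𝒪²`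
  have hgg₁ : ((g * g₁ : GL (Fin 2) (v.adicCompletion ↥(maximalRealSubfield L))) : Matrix (Fin 2) (Fin 2) (v.adicCompletion ↥(maximalRealSubfield L))) =
      ϖF • Matrix.diagonal ![c / ϖF, 1] := by
    rw [Units.val_mul, hg, hg₁, diagonal_mul_diagonal, ← Matrix.diagonal_smul]
    congr 1
    funext i
    fin_cases i <;> simp [mul_div_cancel₀ c h0]
  have hlatt : latt (Matrix.diagonal ![c / ϖF, (1 : v.adicCompletion ↥(maximalRealSubfield L))]) =
      latt (1 : Matrix (Fin 2) (Fin 2) (v.adicCompletion ↥(maximalRealSubfield L))) := by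
    -- `diag(c/ϖ, 1) = D″ ∈ GL₂(𝒪)` with `D″ = Φ D' Φ`… directly: it is the matrix of a `GL₂(𝒪)` element
    have hdet'' : (Matrix.diagonal ![c / ϖF, (1 : v.adicCompletion ↥(maximalRealSubfield L))]).det ≠ 0 := by
      rw [det_diagonal, Fin.prod_univ_two]
      have hc0 : c ≠ 0 := fun h => hv0 (by rw [← hc, h, map_zero])
      simp [div_ne_zero hc0 h0]
    set D'' : GL (Fin 2) (v.adicCompletion ↥(maximalRealSubfield L)) := Matrix.GeneralLinearGroup.mk'' _ (isUnit_iff_ne_zero.2 hdet'') with hD''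
    have hD''val : (D'' : Matrix (Fin 2) (Fin 2) (v.adicCompletion ↥(maximalRealSubfield L))) = Matrix.diagonal ![c / ϖF, 1] := rfl
    have hD''K : D'' ∈ glInt 2 (v.adicCompletion ↥(maximalRealSubfield L)) := by
      refine mem_glInt_of_isIntegralMatrix (fun i j => ?_) (by rw [hD''val, det_diagonal, Fin.prod_univ_two]; simp [hcu])
      rw [hD''val]
      fin_cases i <;> fin_cases j <;> first | (simp [Valuation.mem_integer_iff]; done) | simpa [Valuation.mem_integer_iff] using hcu.le
    have h := latt_mul_of_mem_glInt 1 D'' hD''K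
    rw [one_mul, Units.val_one, hD''val] at h
    exact h
  have hρ : rhoVertexActPlace L v w hw hα hα0 hϖF u x₀ = ⟨_, Or.inl hsd⟩ :=
    (rhoVertexActPlace_eq_iff_exists_zpow L v w hw hα hα0 hϖF u hs hsg x₀ _).2 ⟨-1, by
      rw [_root_.zpow_neg, zpow_one, hx₀, ← hg₁, mapGL_latt, hgg₁, ← scaleLattice_latt, scaleLattice_scaleLattice, inv_mul_cancel₀ h0, scaleLattice_one, hlatt]⟩
  rw [hρ]
  exact (latticeTree_adj_root hϖ' ⟨_, Or.inl hsd⟩ x₀ rfl hx₀).symm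

end Place

end Literature.NumberTheory.Automorphic.UnitaryGroup

end
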